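import Mathlib
import Literature.MathematicalPhysics.StatisticalMechanics.BarlowStacking
import Summits.AtomisticToContinuum.Crystallization.Theorems.ChessboardParticlePlanesLjBilayerHcpNumericReductionAux

/-!
# Crux `ChessboardParticlePlanes.LjBilayerHcp` (stmt-AtomisticToContinuum-6710), line `Sketch` —
# the power sums of the hcp energy at unit spacing: scaling, summability, monotonicity, box + tail bounds

Second helper file of the one-dimensional reduction of the numeric stub `stub_numeric` (see
`ChessboardParticlePlanesLjBilayerHcpNumericReduction.lean`).  Everything is stated for an arbitrary function
`Q : ℤ³ → ℝ` (specialised by the defining equation of the hcp planar form where needed) and takes the registered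
analytic stubs N1 (`stub_hcpPowerSums`), N2 (`stub_powerSums_antitone`), N5 (`stub_powerSum_tail`, at `K = N = 12`)
as HYPOTHESES, so that nothing here depends on their proofs.  With the unscaled families
`G_n(x)(v) = [v ≠ 0](Q v + k² x²)⁻ⁿ` (`v = (k,i,j)`):

* `hcpEnergy_scaled` — `e(hcp a h) = (1/24)(a²)⁻⁶ ∑ G₆(h/a) − (1/12)(a²)⁻³ ∑ G₃(h/a)` (from N1);
* `powerSums_summable_one`, `powerSums_antitone_one` — summability and antitonicity in `x` at `a = 1` (N1, N2);
* `powerSum3_le_box_add_tail`, `powerSum6_le_box_add_tail` — `∑ G₃(x) ≤ box + T(x)` and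
  `∑ G₆(x) ≤ box + ρ(x)⁻³ T(x)`, `ρ(x) = min 1 (min (1/3 + x²) (4x²))` (N5 and `rho_le_base`);
* `box_le_powerSum`, `one_le_boxSum` — the box partial sums are below the series and `≥ 1` (term `v = (0,1,0)`).

All `[folklore]`; no definitions.
-/

noncomputable section

open scoped BigOperators
open Literature.MathematicalPhysics.StatisticalMechanics

namespace Summit.AtomisticToContinuum.Crystallization.Theorems.LjBilayerHcpSketch

/-- **Scaling of the hcp energy series** (from N1): for `a, h ≠ 0`,
`e(hcp a h) = (1/24)(a²)⁻⁶ ∑_v [v≠0](Q v + k²(h/a)²)⁻⁶ − (1/12)(a²)⁻³ ∑_v [v≠0](Q v + k²(h/a)²)⁻³`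
(termwise `a²Q v + k²h² = a²(Q v + k²(h/a)²)`, `tsum_mul_left`). [folklore] -/
theorem hcpEnergy_scaled (Q : ℤ × ℤ × ℤ → ℝ)
    (h1 : ∀ (a h : ℝ) (ha : a ≠ 0) (hh : h ≠ 0),
      (Summable fun v : ℤ × ℤ × ℤ =>
        if v = 0 then (0 : ℝ) else ((a ^ 2 * Q v + (v.1 : ℝ) ^ 2 * h ^ 2)⁻¹) ^ 3) ∧
      (Summable fun v : ℤ × ℤ × ℤ =>
        if v = 0 then (0 : ℝ) else ((a ^ 2 * Q v + (v.1 : ℝ) ^ 2 * h ^ 2)⁻¹) ^ 6) ∧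
      (hcpPeriodicConfiguration ha hh).energyPerParticle lennardJones =
        (1 / 24) * (∑' v : ℤ × ℤ × ℤ,
            if v = 0 then (0 : ℝ) else ((a ^ 2 * Q v + (v.1 : ℝ) ^ 2 * h ^ 2)⁻¹) ^ 6) -
        (1 / 12) * (∑' v : ℤ × ℤ × ℤ,
            if v = 0 then (0 : ℝ) else ((a ^ 2 * Q v + (v.1 : ℝ) ^ 2 * h ^ 2)⁻¹) ^ 3))
    (a h : ℝ) (ha : a ≠ 0) (hh : h ≠ 0) :
    (hcpPeriodicConfiguration ha hh).energyPerParticle lennardJones =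
      (1 / 24) * ((a ^ 2)⁻¹) ^ 6 *
          (∑' v : ℤ × ℤ × ℤ, if v = 0 then (0 : ℝ) else ((Q v + (v.1 : ℝ) ^ 2 * (h / a) ^ 2)⁻¹) ^ 6) -
        (1 / 12) * ((a ^ 2)⁻¹) ^ 3 *
          (∑' v : ℤ × ℤ × ℤ, if v = 0 then (0 : ℝ) else ((Q v + (v.1 : ℝ) ^ 2 * (h / a) ^ 2)⁻¹) ^ 3) := by
  have hscale : ∀ (n : ℕ) (v : ℤ × ℤ × ℤ),
      (if v = 0 then (0 : ℝ) else ((a ^ 2 * Q v + (v.1 : ℝ) ^ 2 * h ^ 2)⁻¹) ^ n) =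
        ((a ^ 2)⁻¹) ^ n * (if v = 0 then (0 : ℝ) else ((Q v + (v.1 : ℝ) ^ 2 * (h / a) ^ 2)⁻¹) ^ n) := by
    intro n v
    split_ifs
    · simp
    · have e : a ^ 2 * Q v + (v.1 : ℝ) ^ 2 * h ^ 2 = a ^ 2 * (Q v + (v.1 : ℝ) ^ 2 * (h / a) ^ 2) := by
        field_simp
      rw [e, mul_inv, mul_pow]
  obtain ⟨-, -, e⟩ := h1 a h ha hh
  rw [e, tsum_congr (hscale 6), tsum_congr (hscale 3), tsum_mul_left, tsum_mul_left]
  ring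

/-- **Summability at unit spacing** (from N1 at `(1, x)`, `x ≠ 0`). [folklore] -/
theorem powerSums_summable_one (Q : ℤ × ℤ × ℤ → ℝ)
    (h1 : ∀ (a h : ℝ) (ha : a ≠ 0) (hh : h ≠ 0),
      (Summable fun v : ℤ × ℤ × ℤ =>
        if v = 0 then (0 : ℝ) else ((a ^ 2 * Q v + (v.1 : ℝ) ^ 2 * h ^ 2)⁻¹) ^ 3) ∧
      (Summable fun v : ℤ × ℤ × ℤ =>
        if v = 0 then (0 : ℝ) else ((a ^ 2 * Q v + (v.1 : ℝ) ^ 2 * h ^ 2)⁻¹) ^ 6) ∧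
      (hcpPeriodicConfiguration ha hh).energyPerParticle lennardJones =
        (1 / 24) * (∑' v : ℤ × ℤ × ℤ,
            if v = 0 then (0 : ℝ) else ((a ^ 2 * Q v + (v.1 : ℝ) ^ 2 * h ^ 2)⁻¹) ^ 6) -
        (1 / 12) * (∑' v : ℤ × ℤ × ℤ,
            if v = 0 then (0 : ℝ) else ((a ^ 2 * Q v + (v.1 : ℝ) ^ 2 * h ^ 2)⁻¹) ^ 3))
    (x : ℝ) (hx : x ≠ 0) :
    (Summable fun v : ℤ × ℤ × ℤ => if v = 0 then (0 : ℝ) else ((Q v + (v.1 : ℝ) ^ 2 * x ^ 2)⁻¹) ^ 3) ∧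
    (Summable fun v : ℤ × ℤ × ℤ => if v = 0 then (0 : ℝ) else ((Q v + (v.1 : ℝ) ^ 2 * x ^ 2)⁻¹) ^ 6) := by
  obtain ⟨s3, s6, -⟩ := h1 1 x one_ne_zero hx
  simp only [one_pow, one_mul] at s3 s6
  exact ⟨s3, s6⟩

/-- **Antitonicity in `x` at unit spacing** (from N2 with `a₁ = a₂ = 1`). [folklore] -/
theorem powerSums_antitone_one (Q : ℤ × ℤ × ℤ → ℝ)
    (h2 : ∀ (n : ℕ) (a₁ h₁ a₂ h₂ : ℝ), 0 < a₁ → a₁ ≤ a₂ → 0 < h₁ → h₁ ≤ h₂ →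
      (Summable fun v : ℤ × ℤ × ℤ =>
        if v = 0 then (0 : ℝ) else ((a₁ ^ 2 * Q v + (v.1 : ℝ) ^ 2 * h₁ ^ 2)⁻¹) ^ n) →
      (Summable fun v : ℤ × ℤ × ℤ =>
        if v = 0 then (0 : ℝ) else ((a₂ ^ 2 * Q v + (v.1 : ℝ) ^ 2 * h₂ ^ 2)⁻¹) ^ n) ∧
      (∑' v : ℤ × ℤ × ℤ,
          if v = 0 then (0 : ℝ) else ((a₂ ^ 2 * Q v + (v.1 : ℝ) ^ 2 * h₂ ^ 2)⁻¹) ^ n) ≤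
        ∑' v : ℤ × ℤ × ℤ,
          if v = 0 then (0 : ℝ) else ((a₁ ^ 2 * Q v + (v.1 : ℝ) ^ 2 * h₁ ^ 2)⁻¹) ^ n)
    (n : ℕ) (x y : ℝ) (hx : 0 < x) (hxy : x ≤ y)
    (hs : Summable fun v : ℤ × ℤ × ℤ => if v = 0 then (0 : ℝ) else ((Q v + (v.1 : ℝ) ^ 2 * x ^ 2)⁻¹) ^ n) :
    (∑' v : ℤ × ℤ × ℤ, if v = 0 then (0 : ℝ) else ((Q v + (v.1 : ℝ) ^ 2 * y ^ 2)⁻¹) ^ n) ≤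
      ∑' v : ℤ × ℤ × ℤ, if v = 0 then (0 : ℝ) else ((Q v + (v.1 : ℝ) ^ 2 * x ^ 2)⁻¹) ^ n := by
  have hs' : Summable fun v : ℤ × ℤ × ℤ => if v = 0 then (0 : ℝ) else
      (((1 : ℝ) ^ 2 * Q v + (v.1 : ℝ) ^ 2 * x ^ 2)⁻¹) ^ n := by
    simp only [one_pow, one_mul]; exact hs
  have key := (h2 n 1 x 1 y one_pos le_rfl hx hxy hs').2
  simp only [one_pow, one_mul] at key
  exact key

/-- **Box + tail for the cube sum** (from N5 at `K = N = 12`): for `x > 0`,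
`∑_v G₃(x) v ≤ ∑_{v ∈ box} G₃(x) v + T(x)`. [folklore] -/
theorem powerSum3_le_box_add_tail (Q : ℤ × ℤ × ℤ → ℝ) (T : ℝ → ℝ)
    (h5 : ∀ (t : ℝ), 0 < t →
      (∑' v : ℤ × ℤ × ℤ,
          if (|v.1| ≤ ((12 : ℕ) : ℤ) ∧ |v.2.1| ≤ ((12 : ℕ) : ℤ) ∧ |v.2.2| ≤ ((12 : ℕ) : ℤ)) then (0 : ℝ)
          else if v = 0 then (0 : ℝ) else (((1 : ℝ) ^ 2 * Q v + (v.1 : ℝ) ^ 2 * t ^ 2)⁻¹) ^ 3) ≤ T t)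
    (x : ℝ) (hx : 0 < x)
    (hs : Summable fun v : ℤ × ℤ × ℤ => if v = 0 then (0 : ℝ) else ((Q v + (v.1 : ℝ) ^ 2 * x ^ 2)⁻¹) ^ 3) :
    (∑' v : ℤ × ℤ × ℤ, if v = 0 then (0 : ℝ) else ((Q v + (v.1 : ℝ) ^ 2 * x ^ 2)⁻¹) ^ 3) ≤
      (∑ v ∈ Finset.Icc (-12 : ℤ) 12 ×ˢ (Finset.Icc (-12 : ℤ) 12 ×ˢ Finset.Icc (-12 : ℤ) 12),
          if v = 0 then (0 : ℝ) else ((Q v + (v.1 : ℝ) ^ 2 * x ^ 2)⁻¹) ^ 3) + T x := by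
  classical
  rw [tsum_eq_sum_add_tsum_ite hs (Finset.Icc (-12 : ℤ) 12 ×ˢ (Finset.Icc (-12 : ℤ) 12 ×ˢ Finset.Icc (-12 : ℤ) 12))]
  have key := h5 x hx
  have e : (fun v : ℤ × ℤ × ℤ => if (|v.1| ≤ ((12 : ℕ) : ℤ) ∧ |v.2.1| ≤ ((12 : ℕ) : ℤ) ∧
      |v.2.2| ≤ ((12 : ℕ) : ℤ)) then (0 : ℝ)
      else if v = 0 then (0 : ℝ) else (((1 : ℝ) ^ 2 * Q v + (v.1 : ℝ) ^ 2 * x ^ 2)⁻¹) ^ 3) =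
      fun v => if v ∈ Finset.Icc (-12 : ℤ) 12 ×ˢ (Finset.Icc (-12 : ℤ) 12 ×ˢ Finset.Icc (-12 : ℤ) 12) then 0
        else (if v = 0 then (0 : ℝ) else ((Q v + (v.1 : ℝ) ^ 2 * x ^ 2)⁻¹) ^ 3) := by
    funext v
    simp only [mem_box_iff, one_pow, one_mul, Nat.cast_ofNat]
  rw [e] at key
  linarith

/-- **Box + tail for the sixth-power sum**: for `x > 0`,
`∑_v G₆(x) v ≤ ∑_{v ∈ box} G₆(x) v + ρ(x)⁻³ T(x)` with `ρ(x) = min 1 (min (1/3 + x²) (4x²))` — outside the box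
`v ≠ 0`, so `Q v + k²x² ≥ ρ(x)` (`rho_le_base`) and `(q⁻¹)⁶ ≤ ρ⁻³ (q⁻¹)³`. [folklore] -/
theorem powerSum6_le_box_add_tail (Q : ℤ × ℤ × ℤ → ℝ)
    (hQ : Q = fun v => (v.2.1 : ℝ) ^ 2 + (v.2.1 : ℝ) * v.2.2 + (v.2.2 : ℝ) ^ 2 +
      (if Even v.1 then 0 else ((v.2.1 : ℝ) + v.2.2 + 1 / 3)))
    (T : ℝ → ℝ)
    (h5 : ∀ (t : ℝ), 0 < t →
      (∑' v : ℤ × ℤ × ℤ,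
          if (|v.1| ≤ ((12 : ℕ) : ℤ) ∧ |v.2.1| ≤ ((12 : ℕ) : ℤ) ∧ |v.2.2| ≤ ((12 : ℕ) : ℤ)) then (0 : ℝ)
          else if v = 0 then (0 : ℝ) else (((1 : ℝ) ^ 2 * Q v + (v.1 : ℝ) ^ 2 * t ^ 2)⁻¹) ^ 3) ≤ T t)
    (x : ℝ) (hx : 0 < x)
    (hs3 : Summable fun v : ℤ × ℤ × ℤ => if v = 0 then (0 : ℝ) else ((Q v + (v.1 : ℝ) ^ 2 * x ^ 2)⁻¹) ^ 3)
    (hs6 : Summable fun v : ℤ × ℤ × ℤ => if v = 0 then (0 : ℝ) else ((Q v + (v.1 : ℝ) ^ 2 * x ^ 2)⁻¹) ^ 6) :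
    (∑' v : ℤ × ℤ × ℤ, if v = 0 then (0 : ℝ) else ((Q v + (v.1 : ℝ) ^ 2 * x ^ 2)⁻¹) ^ 6) ≤
      (∑ v ∈ Finset.Icc (-12 : ℤ) 12 ×ˢ (Finset.Icc (-12 : ℤ) 12 ×ˢ Finset.Icc (-12 : ℤ) 12),
          if v = 0 then (0 : ℝ) else ((Q v + (v.1 : ℝ) ^ 2 * x ^ 2)⁻¹) ^ 6) +
        ((min 1 (min (1 / 3 + x ^ 2) (4 * x ^ 2)))⁻¹) ^ 3 * T x := by
  classical
  set I : Finset (ℤ × ℤ × ℤ) :=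
    Finset.Icc (-12 : ℤ) 12 ×ˢ (Finset.Icc (-12 : ℤ) 12 ×ˢ Finset.Icc (-12 : ℤ) 12) with hI
  set ρ : ℝ := min 1 (min (1 / 3 + x ^ 2) (4 * x ^ 2)) with hρ
  have hρ0 : 0 < ρ := rho_pos hx
  have hout3 : (∑' v, if v ∈ I then 0 else
      (if v = 0 then (0 : ℝ) else ((Q v + (v.1 : ℝ) ^ 2 * x ^ 2)⁻¹) ^ 3)) ≤ T x := by
    have := powerSum3_le_box_add_tail Q T h5 x hx hs3
    rw [tsum_eq_sum_add_tsum_ite hs3 I] at this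
    linarith
  have hterm : ∀ v : ℤ × ℤ × ℤ,
      (if v ∈ I then 0 else (if v = 0 then (0 : ℝ) else ((Q v + (v.1 : ℝ) ^ 2 * x ^ 2)⁻¹) ^ 6)) ≤
        (ρ⁻¹) ^ 3 * (if v ∈ I then 0 else
          (if v = 0 then (0 : ℝ) else ((Q v + (v.1 : ℝ) ^ 2 * x ^ 2)⁻¹) ^ 3)) := by
    intro v
    split_ifs with hv hv0
    · simp
    · simp
    · have hb : ρ ≤ Q v + (v.1 : ℝ) ^ 2 * x ^ 2 := by
        rw [hρ, hQ]; exact rho_le_base hv0 hx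
      have hq0 : 0 < Q v + (v.1 : ℝ) ^ 2 * x ^ 2 := hρ0.trans_le hb
      have hinv : (Q v + (v.1 : ℝ) ^ 2 * x ^ 2)⁻¹ ≤ ρ⁻¹ := (inv_le_inv₀ hq0 hρ0).2 hb
      have hinv0 : 0 ≤ (Q v + (v.1 : ℝ) ^ 2 * x ^ 2)⁻¹ := inv_nonneg.2 hq0.le
      calc ((Q v + (v.1 : ℝ) ^ 2 * x ^ 2)⁻¹) ^ 6
          = ((Q v + (v.1 : ℝ) ^ 2 * x ^ 2)⁻¹) ^ 3 * ((Q v + (v.1 : ℝ) ^ 2 * x ^ 2)⁻¹) ^ 3 := by ring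
        _ ≤ (ρ⁻¹) ^ 3 * ((Q v + (v.1 : ℝ) ^ 2 * x ^ 2)⁻¹) ^ 3 := by gcongr
  have hs6' := summable_ite_compl hs6 I
  have hs3' := (summable_ite_compl hs3 I).mul_left ((ρ⁻¹) ^ 3)
  have hle := Summable.tsum_le_tsum hterm hs6' hs3'
  rw [tsum_mul_left] at hle
  rw [tsum_eq_sum_add_tsum_ite hs6 I]
  have hρ3 : 0 ≤ (ρ⁻¹) ^ 3 := pow_nonneg (inv_nonneg.2 hρ0.le) _
  nlinarith [mul_le_mul_of_nonneg_left hout3 hρ3]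

/-- The terms `[v ≠ 0](Q v + k²x²)⁻ⁿ` are non-negative (for the hcp planar form `Q ≥ 0`). [folklore] -/
theorem powerSums_term_nonneg (Q : ℤ × ℤ × ℤ → ℝ)
    (hQ : Q = fun v => (v.2.1 : ℝ) ^ 2 + (v.2.1 : ℝ) * v.2.2 + (v.2.2 : ℝ) ^ 2 +
      (if Even v.1 then 0 else ((v.2.1 : ℝ) + v.2.2 + 1 / 3)))
    (n : ℕ) (x : ℝ) (v : ℤ × ℤ × ℤ) :
    0 ≤ (if v = 0 then (0 : ℝ) else ((Q v + (v.1 : ℝ) ^ 2 * x ^ 2)⁻¹) ^ n) := by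
  have hQnn : 0 ≤ Q v := by rw [hQ]; exact planarForm_nonneg v
  split_ifs
  · exact le_rfl
  · exact pow_nonneg (inv_nonneg.2 (by nlinarith [sq_nonneg ((v.1 : ℝ) * x)])) _

/-- **The box partial sum is below the series.** [folklore] -/
theorem box_le_powerSum (Q : ℤ × ℤ × ℤ → ℝ)
    (hQ : Q = fun v => (v.2.1 : ℝ) ^ 2 + (v.2.1 : ℝ) * v.2.2 + (v.2.2 : ℝ) ^ 2 +
      (if Even v.1 then 0 else ((v.2.1 : ℝ) + v.2.2 + 1 / 3)))
    (n : ℕ) (x : ℝ)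
    (hs : Summable fun v : ℤ × ℤ × ℤ => if v = 0 then (0 : ℝ) else ((Q v + (v.1 : ℝ) ^ 2 * x ^ 2)⁻¹) ^ n) :
    (∑ v ∈ Finset.Icc (-12 : ℤ) 12 ×ˢ (Finset.Icc (-12 : ℤ) 12 ×ˢ Finset.Icc (-12 : ℤ) 12),
        if v = 0 then (0 : ℝ) else ((Q v + (v.1 : ℝ) ^ 2 * x ^ 2)⁻¹) ^ n) ≤
      ∑' v : ℤ × ℤ × ℤ, if v = 0 then (0 : ℝ) else ((Q v + (v.1 : ℝ) ^ 2 * x ^ 2)⁻¹) ^ n :=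
  sum_le_tsum_of_nonneg hs (powerSums_term_nonneg Q hQ n x) _


/-- **Registered sub-goal `numericSums_box_le_powerSum` (anchor of this helper file):** the box partial sum of the
power family is below the full series, binder-free spelling of `box_le_powerSum`. [folklore] -/
theorem numericSums_box_le_powerSum :
    ∀ (Q : ℤ × ℤ × ℤ → ℝ),
    (Q = fun v => (v.2.1 : ℝ) ^ 2 + (v.2.1 : ℝ) * v.2.2 + (v.2.2 : ℝ) ^ 2 +
      (if Even v.1 then 0 else ((v.2.1 : ℝ) + v.2.2 + 1 / 3))) →
    ∀ (n : ℕ) (x : ℝ),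
      (Summable fun v : ℤ × ℤ × ℤ => if v = 0 then (0 : ℝ) else ((Q v + (v.1 : ℝ) ^ 2 * x ^ 2)⁻¹) ^ n) →
      (∑ v ∈ Finset.Icc (-12 : ℤ) 12 ×ˢ (Finset.Icc (-12 : ℤ) 12 ×ˢ Finset.Icc (-12 : ℤ) 12),
          if v = 0 then (0 : ℝ) else ((Q v + (v.1 : ℝ) ^ 2 * x ^ 2)⁻¹) ^ n) ≤
        ∑' v : ℤ × ℤ × ℤ, if v = 0 then (0 : ℝ) else ((Q v + (v.1 : ℝ) ^ 2 * x ^ 2)⁻¹) ^ n :=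
  fun Q hQ n x hs => box_le_powerSum Q hQ n x hs

/-- **The box partial sums are `≥ 1`**: the term `v = (0, 1, 0)` equals `1` (`Q(0,1,0) = 1`) and all terms are
`≥ 0`. [folklore] -/
theorem one_le_boxSum (Q : ℤ × ℤ × ℤ → ℝ)
    (hQ : Q = fun v => (v.2.1 : ℝ) ^ 2 + (v.2.1 : ℝ) * v.2.2 + (v.2.2 : ℝ) ^ 2 +
      (if Even v.1 then 0 else ((v.2.1 : ℝ) + v.2.2 + 1 / 3)))
    (n : ℕ) (x : ℝ) :
    1 ≤ ∑ v ∈ Finset.Icc (-12 : ℤ) 12 ×ˢ (Finset.Icc (-12 : ℤ) 12 ×ˢ Finset.Icc (-12 : ℤ) 12),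
        if v = 0 then (0 : ℝ) else ((Q v + (v.1 : ℝ) ^ 2 * x ^ 2)⁻¹) ^ n := by
  have hmem : ((0 : ℤ), (1 : ℤ), (0 : ℤ)) ∈
      Finset.Icc (-12 : ℤ) 12 ×ˢ (Finset.Icc (-12 : ℤ) 12 ×ˢ Finset.Icc (-12 : ℤ) 12) := by
    simp only [mem_box_iff]; norm_num
  have h1le := Finset.single_le_sum
    (f := fun v : ℤ × ℤ × ℤ => if v = 0 then (0 : ℝ) else ((Q v + (v.1 : ℝ) ^ 2 * x ^ 2)⁻¹) ^ n)
    (fun v _ => powerSums_term_nonneg Q hQ n x v) hmem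
  have hval : (if ((0 : ℤ), (1 : ℤ), (0 : ℤ)) = (0 : ℤ × ℤ × ℤ) then (0 : ℝ)
      else ((Q ((0 : ℤ), (1 : ℤ), (0 : ℤ)) + (((0 : ℤ) : ℝ)) ^ 2 * x ^ 2)⁻¹) ^ n) = 1 := by
    rw [if_neg (by simp), hQ]
    simp
  simp only [hval] at h1le
  exact h1le

end Summit.AtomisticToContinuum.Crystallization.Theorems.LjBilayerHcpSketch

end
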